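import Literature.MathematicalPhysics.QuantumLattice.KaplanHorschVonDerLindenOverlap
import Literature.MathematicalPhysics.QuantumLattice.DWaveKomaTasakiSystem
import Literature.MathematicalPhysics.QuantumLattice.KomaPiFluxLROGroundState
import Literature.MathematicalPhysics.QuantumLattice.KomaTasakiThermalFiniteVolumeFieldBound
import Literature.MathematicalPhysics.QuantumLattice.DWaveKomaTasakiThermal
import Literature.MathematicalPhysics.QuantumLattice.DWaveKomaTasakiThermalTTPrime
import HarnessLib

/-!
# Koma–Tasaki in ONE finite volume for the pair field of the 2D Hubbard model: certified pair long-range order on an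
# `L × L` torus gives an explicit floor on the sourced pair amplitude on that torus — at `T = 0` (KT93 (7.10), every
# ground state of `H(t,U) - μN - B(Δ_g + Δ_g†)`) and at `T > 0` (KT93 Theorem 2.1, the sourced Gibbs state)

T. Koma, H. Tasaki, Commun. Math. Phys. **158** (1993) 191–214 (`KomaTasaki1993`), §7, Theorem 7.1 and (7.10)
("`N⁻¹(Φ_Λ(B),O_ΛΦ_Λ(B)) ≥ σ_Λ - O(N⁻¹)/(BN)`"), p. 211 (application "to the electron pair condensation problems in
lattice electron systems"); J. Stat. Phys. **76** (1994) 745–803 (`KomaTasaki1994`), Theorem 2.2 and §3.3–3.4 (Hubbard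
model, bond pair fields, "with some extra care").

The grand-canonical Hubbard torus `(ℤ/Lℤ)²` with a pair field `Δ_g = pairField g L` (ANY form factor `g` on
`{0, ±e₁, ±e₂}` with `K_g = pairNormConst g > 0`; `d`-wave: `dWaveFormFactor`) IS a bounded-overlap Koma–Tasaki
`U(1)` system (`dWaveKTSystem`, `DWaveKomaTasakiSystem.lean`: `r = r′ = 25`, `h̄ = 45(2|t|+|U|+2|μ|)`, `ō = 2K_g`,
`C = N/2`).  Reading the tree's overlap Kaplan–Horsch–von der Linden bound
(`KomaTasaki.U1OverlapSystem.kaplanHorschVonDerLinden_order_density`, `KaplanHorschVonDerLindenOverlap.lean`) through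
its dictionary gives, with NO limit, NO size condition and NO assumption on `t, U, μ`:

* `hubbard_ground_sourcedPairing_ge_finiteVolume` — if a normalised ground-state vector `Φ` of `H(t,U) - μN` in a
  particle-number sector (`NΦ = νΦ`) has pair long-range order `(sL²)² ≤ Re Φ†(Δ_g+Δ_g†)²Φ`, `s > 0`, then for every
  `B > 0` and EVERY normalised ground-state vector `Φ_B` of `H(t,U) - μN - B(Δ_g+Δ_g†)`:
  **`L⁻² Re Φ_B†(Δ_g+Δ_g†)Φ_B ≥ s - 1250·45(2|t|+|U|+2|μ|)·(2K_g)²/(s²BL⁴)`**;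
* `…_of_groundStateFunctional` — the same from the TRACIAL certificate `s²L⁴ ≤ Re ω_GS((Δ_g+Δ_g†)²)` (a ground state in
  a particle-number sector at least as ordered exists, `Matrix.exists_groundState_eigenvector_re_ge`);
* `dWave_ground_sourcedPairing_ge_finiteVolume` — `t = 1`, `g = dWaveFormFactor`: the sourced Hamiltonian is the tree's
  `dWaveSourceTorus L U μ B`;
* `T > 0` (§2, `dWave_thermal_sourcedPairing_ge_finiteVolume`): a number `s ≤ L⁻⁴Re⟨(Δ_d+Δ_d†)²⟩_{β,B=0}` gives
  **`L⁻² Re⟨Δ_d+Δ_d†⟩_{β, dWaveSourceTorus L U μ B} ≥ √(s - E) - τ`** for every `B > 0`, `τ ≥ 0`, `ℓ > 0`, `K ≥ 1`, with the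
  explicit `E` of KT93 (5.3) — `KomaTasaki.Z2System.sqrt_sub_le_magnetisation_add` over the tree's `dWaveZ2System`.
* `T > 0`, every `t'` (§3, `dWave_thermal_sourcedPairing_ge_finiteVolume_TT'`): the same on the pair-sourced `t–t'` torus
  `dWaveSourceTorusTT' L t' U μ B` (`h̄ = 45(2+|U|+2|μ|)+18|t'|`, `r = 45`; via `dWaveZ2SystemTT'`).

These are implications LRO ⟹ sourced order in one finite volume; NO long-range order of the Hubbard ground state is
asserted anywhere in this file (cf. the barrier `SourcedOrderWithoutGroundStateLRO` for the converse direction).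
Theorems only, no named facts, no sorry; `attribute [local instance 10000] instDecidableEqFermionTorusKT` (§1) /
`instDecidableEqFermionTorusKTThermal` (§2) as in the companions of `DWaveKomaTasakiSystem.lean` / `DWaveKomaTasakiThermal.lean`.

## References
* [KomaTasaki1993] T. Koma, H. Tasaki, Commun. Math. Phys. **158** (1993) 191–214, Theorem 7.1 (7.10), i'); p. 211.
* [KomaTasaki1994] T. Koma, H. Tasaki, J. Stat. Phys. **76** (1994) 745–803, Theorem 2.2, §2.3 iv), §3.3–3.4.
* [KaplanHorschVonDerLinden1989] T. A. Kaplan, P. Horsch, W. von der Linden, J. Phys. Soc. Jpn. **58** (1989) 3894.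
* [Tasaki2020] H. Tasaki, *Physics and Mathematics of Quantum Many-Body Systems* (2020), §2.1 (variational principle).
-/

noncomputable section

open Matrix Complex Finset WithLp Literature.Probability.LatticeModels
open Literature.Barriers.HubbardSuperconductivity
open scoped Matrix.Norms.L2Operator InnerProductSpace ComplexConjugate ComplexOrder

namespace Literature.MathematicalPhysics.QuantumLattice

open KomaTasaki DWaveKT

/-! ### §1. `T = 0`: KT93 (7.10) with bounded overlap on one torus -/

section GroundState

attribute [local instance 10000] instDecidableEqFermionTorusKT

variable {L : ℕ} [NeZero L]

omit [NeZero L] in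
/-- `⟨toLp x, toLp y⟩ = x† y`. [folklore] -/
private theorem inner_toLp_toLp_eq'' (x y : FockIdx L → ℂ) :
    ⟪(toLp 2 x : EuclideanSpace ℂ (FockIdx L)), toLp 2 y⟫_ℂ = star x ⬝ᵥ y := by
  rw [EuclideanSpace.inner_toLp_toLp, dotProduct_comm]

variable (L) (t U μ : ℝ) (g : Site 2 → ℝ)

/-- **KT93 (7.10) FOR THE PAIR FIELD OF THE 2D HUBBARD MODEL, ONE TORUS, explicit constant.**  On `(ℤ/Lℤ)²`, for
ANY `t, U, μ` and any pair form factor `g` with `K_g = pairNormConst g > 0`: if `Φ` is a normalised ground-state vector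
of `H(t,U) - μN = hubbardTorusWith 2 L t U μ` lying in a particle-number sector (`NΦ = νΦ`) with pair long-range order
`(sL²)² ≤ Re Φ†(Δ_g+Δ_g†)²Φ`, `s > 0`, then for every `B > 0` and EVERY normalised ground-state vector `Φ_B` of
`H(t,U) - μN - B(Δ_g+Δ_g†)`:
**`L⁻² Re Φ_B†(Δ_g+Δ_g†)Φ_B ≥ s - 1250·45(2|t|+|U|+2|μ|)/((s/(2K_g))²·B·L⁴)`**.
`= U1OverlapSystem.kaplanHorschVonDerLinden_order_density_of_isLROEigenstate` over `dWaveKTSystem` (hypothesis iv) by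
`dWaveKTSystem_isLROEigenstate`, `μ' = s/(2K_g) ≤ 1` derived by `U1System.mu_le_one_of_re_inner_order_sq_ge` on the collapse).
[cite: KomaTasaki1993, Theorem 7.1 (7.10); p. 211] [cite: KomaTasaki1994, Theorem 2.2, §3.3–3.4] [cite: KaplanHorschVonDerLinden1989, main theorem] -/
theorem hubbard_ground_sourcedPairing_ge_finiteVolume (hg : 0 < pairNormConst g) {s : ℝ} (hs : 0 < s)
    {Φ : FockIdx L → ℂ} {ν : ℂ}
    (hΦ1 : star Φ ⬝ᵥ Φ = 1) (hgs : (hubbardTorusWith 2 L t U μ).IsGroundStateVector Φ)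
    (hN : totalNumber *ᵥ Φ = ν • Φ)
    (hlro : (s * (L : ℝ) ^ 2) ^ 2 ≤
      (star Φ ⬝ᵥ ((pairField g L + (pairField g L)ᴴ) *ᵥ ((pairField g L + (pairField g L)ᴴ) *ᵥ Φ))).re)
    {B : ℝ} (hB : 0 < B) {ΦB : FockIdx L → ℂ} (hΦB1 : star ΦB ⬝ᵥ ΦB = 1)
    (hgsB : (hubbardTorusWith 2 L t U μ - (B : ℂ) • (pairField g L + (pairField g L)ᴴ)).IsGroundStateVector ΦB) :
    s - 1250 * (45 * (2 * |t| + |U| + 2 * |μ|)) / (s / (2 * pairNormConst g)) ^ 2 / (B * ((L : ℝ) ^ 2) ^ 2) ≤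
      (star ΦB ⬝ᵥ ((pairField g L + (pairField g L)ᴴ) *ᵥ ΦB)).re / (L : ℝ) ^ 2 := by
  set K : ℝ := pairNormConst g with hKdef
  set μ' : ℝ := s / (2 * K) with hμ'def
  have hK : 0 < K := hg
  have hμ' : 0 < μ' := div_pos hs (mul_pos two_pos hK)
  have hsμ : μ' * (2 * K) = s := by rw [hμ'def, div_mul_cancel₀ _ (mul_pos two_pos hK).ne']
  set sys := dWaveKTSystem L t U μ g hg with hsys
  have hcardR : (Fintype.card (TorusSite 2 L) : ℝ) = (L : ℝ) ^ 2 := by rw [card_torusSite_two L, Nat.cast_pow]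
  -- hypothesis iv): the LRO inequality with `μ' ō L² = s L²`
  have hlro' : (μ' * (2 * pairNormConst g) * (L : ℝ) ^ 2) ^ 2 ≤
      (star Φ ⬝ᵥ ((pairField g L + (pairField g L)ᴴ) *ᵥ ((pairField g L + (pairField g L)ᴴ) *ᵥ Φ))).re := by
    rw [← hKdef, hsμ]; exact hlro
  -- `μ' ≤ 1` (from `‖Δ_g+Δ_g†‖ ≤ 2K_g L²`, via the one-site collapse)
  have hΦ1' : ‖(toLp 2 Φ : EuclideanSpace ℂ (FockIdx L))‖ = 1 := norm_toLp_eq_one_of_dotProduct hΦ1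
  have hlro₁ : (μ' * sys.collapse.obar * Fintype.card Unit) ^ 2 ≤
      (⟪(toLp 2 Φ : EuclideanSpace ℂ (FockIdx L)),
        sys.collapse.order 0 (sys.collapse.order 0 (toLp 2 Φ))⟫_ℂ).re := by
    rw [U1OverlapSystem.collapse_order, U1OverlapSystem.collapse_obar, Fintype.card_unit, Nat.cast_one, mul_one,
      hcardR, ← mul_assoc, hsys, dWaveKTSystem_obar, dWaveKTSystem_order_zero, toEuclideanCLM_toLp,
      toEuclideanCLM_toLp, inner_toLp_toLp_eq'']
    exact hlro'
  have hμ'1 : μ' ≤ 1 := sys.collapse.mu_le_one_of_re_inner_order_sq_ge 0 hΦ1' hlro₁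
  have hLRO := dWaveKTSystem_isLROEigenstate (L := L) t U μ g hg hΦ1 hgs.2 hN hμ' hμ'1 hlro'
  -- ground-state properties
  have hH : (hubbardTorusWith 2 L t U μ).IsHermitian := isHermitian_hubbardTorusWith L t U μ
  have hground : ∀ ψ : EuclideanSpace ℂ (FockIdx L), ‖ψ‖ = 1 →
      (hubbardTorusWith 2 L t U μ).groundEnergy ≤ (⟪ψ, sys.hamiltonian ψ⟫_ℂ).re := by
    intro ψ hψ
    rw [hsys, dWaveKTSystem_hamiltonian]
    exact groundEnergy_le_re_inner_toEuclideanCLM hH ψ hψ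
  have hKB : (hubbardTorusWith 2 L t U μ - (B : ℂ) • (pairField g L + (pairField g L)ᴴ)).IsHermitian :=
    hH.sub ((isHermitian_add_transpose_self _).smul (by rw [isSelfAdjoint_iff, Complex.star_def, Complex.conj_ofReal]))
  have hΦB1' : ‖(toLp 2 ΦB : EuclideanSpace ℂ (FockIdx L))‖ = 1 := norm_toLp_eq_one_of_dotProduct hΦB1
  have hmin : ∀ ψ : EuclideanSpace ℂ (FockIdx L), ‖ψ‖ = 1 →
      (⟪(toLp 2 ΦB : EuclideanSpace ℂ (FockIdx L)), (sys.hamiltonian - (B : ℂ) • sys.order 0) (toLp 2 ΦB)⟫_ℂ).re ≤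
        (⟪ψ, (sys.hamiltonian - (B : ℂ) • sys.order 0) ψ⟫_ℂ).re := by
    intro ψ hψ
    rw [hsys, dWaveKTSystem_field]
    exact re_inner_le_of_groundState hKB hΦB1 hgsB.2 ψ hψ
  -- KT93 (7.10) with bounded overlap
  have h := sys.kaplanHorschVonDerLinden_order_density_of_isLROEigenstate hLRO hground hB hΦB1' hmin
  have eB : (⟪(toLp 2 ΦB : EuclideanSpace ℂ (FockIdx L)), sys.order 0 (toLp 2 ΦB)⟫_ℂ).re =
      (star ΦB ⬝ᵥ ((pairField g L + (pairField g L)ᴴ) *ᵥ ΦB)).re := by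
    rw [hsys, dWaveKTSystem_order_zero, toEuclideanCLM_toLp, inner_toLp_toLp_eq'']
  have e25 : ((25 : ℕ) : ℝ) * ((25 : ℕ) + (25 : ℕ) : ℕ) = 1250 := by norm_num
  rw [eB, hcardR, hsys, dWaveKTSystem_obar, dWaveKTSystem_hbar, dWaveKTSystem_r, dWaveKTSystem_r', ← hKdef, hsμ]
    at h
  push_cast at h
  have e : (25 : ℝ) * (25 + 25) = 1250 := by norm_num
  rw [e] at h
  exact h

/-- **The same from the tracial certificate.**  If `s²L⁴ ≤ Re ω_GS((Δ_g+Δ_g†)²)` for the tracial ground state `ω_GS`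
of `H(t,U) - μN` on `(ℤ/Lℤ)²` (`Matrix.groundStateFunctional`), `s > 0`, then some normalised ground-state vector in a
particle-number sector is at least as ordered (`Matrix.exists_groundState_eigenvector_re_ge`, `[H, N] = 0`), hence
for every `B > 0` and every normalised ground-state vector `Φ_B` of `H(t,U) - μN - B(Δ_g+Δ_g†)`:
`L⁻² Re Φ_B†(Δ_g+Δ_g†)Φ_B ≥ s - 1250·45(2|t|+|U|+2|μ|)/((s/(2K_g))²BL⁴)`.
[cite: KomaTasaki1993, Theorem 7.1 (7.10); p. 211] [cite: KomaTasaki1994, Theorem 2.2, §3.3–3.4] [cite: Tasaki2020, §2.1] -/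
theorem hubbard_ground_sourcedPairing_ge_finiteVolume_of_groundStateFunctional (hg : 0 < pairNormConst g) {s : ℝ}
    (hs : 0 < s)
    (hlro : s ^ 2 * ((L : ℝ) ^ 2) ^ 2 ≤
      ((hubbardTorusWith 2 L t U μ).groundStateFunctional
        ((pairField g L + (pairField g L)ᴴ) * (pairField g L + (pairField g L)ᴴ))).re)
    {B : ℝ} (hB : 0 < B) {ΦB : FockIdx L → ℂ} (hΦB1 : star ΦB ⬝ᵥ ΦB = 1)
    (hgsB : (hubbardTorusWith 2 L t U μ - (B : ℂ) • (pairField g L + (pairField g L)ᴴ)).IsGroundStateVector ΦB) :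
    s - 1250 * (45 * (2 * |t| + |U| + 2 * |μ|)) / (s / (2 * pairNormConst g)) ^ 2 / (B * ((L : ℝ) ^ 2) ^ 2) ≤
      (star ΦB ⬝ᵥ ((pairField g L + (pairField g L)ᴴ) *ᵥ ΦB)).re / (L : ℝ) ^ 2 := by
  have hH : (hubbardTorusWith 2 L t U μ).IsHermitian := isHermitian_hubbardTorusWith L t U μ
  obtain ⟨Φ, hΦ, hHΦ, ⟨ν, hNΦ⟩, hlroΦ⟩ := Matrix.exists_groundState_eigenvector_re_ge hH totalNumber_isHermitian
    (hamiltonianWith_commute_totalNumber (fermionTorusGraph 2 L) t U μ).eq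
    ((pairField g L + (pairField g L)ᴴ) * (pairField g L + (pairField g L)ᴴ))
  have hne : Φ ≠ 0 := by
    intro h0
    rw [h0, dotProduct_zero] at hΦ
    exact zero_ne_one hΦ
  refine hubbard_ground_sourcedPairing_ge_finiteVolume L t U μ g hg hs hΦ ⟨hne, hHΦ⟩ hNΦ ?_ hB hΦB1 hgsB
  rw [mul_pow, Matrix.mulVec_mulVec]
  exact hlro.trans hlroΦ

/-- **The `d`-wave case, `t = 1`: the tree's sourced Hamiltonian `dWaveSourceTorus L U μ B = H(1,U) - μN - B(Δ_d+Δ_d†)`.**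
If `s²L⁴ ≤ Re ω_GS((Δ_d+Δ_d†)²)` for the tracial ground state of `H(1,U) - μN` on `(ℤ/Lℤ)²`, `s > 0`, then for every
`B > 0` and every normalised ground-state vector `Φ_B` of `dWaveSourceTorus L U μ B`:
**`L⁻² Re Φ_B†(Δ_d+Δ_d†)Φ_B ≥ s - 1250·45(2+|U|+2|μ|)/((s/(2K_d))²BL⁴)`**, `K_d = pairNormConst dWaveFormFactor`.
[cite: KomaTasaki1993, Theorem 7.1 (7.10); p. 211] [cite: KomaTasaki1994, §1, Theorem 2.2, §3.3–3.4] -/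
theorem dWave_ground_sourcedPairing_ge_finiteVolume {s : ℝ} (hs : 0 < s)
    (hlro : s ^ 2 * ((L : ℝ) ^ 2) ^ 2 ≤
      ((hubbardTorusWith 2 L 1 U μ).groundStateFunctional
        ((pairField dWaveFormFactor L + (pairField dWaveFormFactor L)ᴴ) *
          (pairField dWaveFormFactor L + (pairField dWaveFormFactor L)ᴴ))).re)
    {B : ℝ} (hB : 0 < B) {ΦB : FockIdx L → ℂ} (hΦB1 : star ΦB ⬝ᵥ ΦB = 1)
    (hgsB : (dWaveSourceTorus L U μ B).IsGroundStateVector ΦB) :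
    s - 1250 * (45 * (2 + |U| + 2 * |μ|)) / (s / (2 * pairNormConst dWaveFormFactor)) ^ 2 /
        (B * ((L : ℝ) ^ 2) ^ 2) ≤
      (star ΦB ⬝ᵥ ((pairField dWaveFormFactor L + (pairField dWaveFormFactor L)ᴴ) *ᵥ ΦB)).re / (L : ℝ) ^ 2 := by
  rw [dWaveSourceTorus_eq_sub] at hgsB
  have h := hubbard_ground_sourcedPairing_ge_finiteVolume_of_groundStateFunctional L 1 U μ dWaveFormFactor
    pairNormConst_dWave_pos hs hlro hB hΦB1 hgsB
  rw [abs_one, mul_one] at h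
  exact h

end GroundState

/-! ### §2. `T > 0`: KT93 Theorem 2.1 ((5.3) + (4.6)) on one torus, `d`-wave pair field -/

section Thermal

attribute [local instance 10000] instDecidableEqFermionTorusKTThermal

/-- **KT93 THEOREM 2.1 IN ONE FINITE VOLUME FOR THE `d`-WAVE PAIR FIELD OF THE 2D HUBBARD MODEL (`T > 0`).**
On `(ℤ/Lℤ)²`, `H(1,U) - μN` with the `d`-wave pair field `Δ_d` (`dWaveSourceTorus L U μ B = H(1,U) - μN - B(Δ_d+Δ_d†)`):
if a number `s` satisfies `s ≤ L⁻⁴ Re⟨(Δ_d+Δ_d†)²⟩_{β, B=0}` (a certified lower bound on the THERMAL pair long-range order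
of the symmetric Gibbs state on this torus), then for every `β > 0`, `B > 0`, `τ ≥ 0`, `ℓ > 0`, `K ≥ 1`:
**`L⁻² Re⟨Δ_d+Δ_d†⟩_{β, dWaveSourceTorus L U μ B} ≥ √(s - E) - τ`**,
`E = 32(2rh̄)²ō²K²/ℓ² + 2ō²/K + 2ō²e^{βℓ}e^{-βL²Bτ}` with `r = 25`, `h̄ = 45(2+|U|+2|μ|)`, `ō = 2K_d`
— `KomaTasaki.Z2System.sqrt_sub_le_magnetisation_add` ((5.3) at `m = (f(0)-f(B))/B + τ` plus (4.6)) over the tree's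
`dWaveZ2System` (`DWaveKomaTasakiThermal.lean`).  No thermodynamic-limit hypothesis, no window on `U, μ, β`; NO thermal
pair order of the Hubbard model is asserted (the number `s` is the input).
[cite: KomaTasaki1993, Theorem 2.1, §4 (4.6), §5 (5.3); p. 211] [cite: KomaTasaki1994, §3.3–3.4] -/
theorem dWave_thermal_sourcedPairing_ge_finiteVolume (L : ℕ) [NeZero L] (U μ : ℝ) {β : ℝ} (hβ : 0 < β) {B : ℝ}
    (hB : 0 < B) {τ : ℝ} (hτ : 0 ≤ τ) {ℓ : ℝ} (hℓ : 0 < ℓ) {K : ℕ} (hK : 1 ≤ K) {s : ℝ}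
    (hcert : s ≤ (((L : ℝ) ^ 2) ^ 2)⁻¹ * (gibbsState β (dWaveSourceTorus L U μ 0)
      ((pairField dWaveFormFactor L + (pairField dWaveFormFactor L)ᴴ) ^ 2)).re) :
    Real.sqrt (s - (32 * (2 * 25 * (45 * (2 + |U| + 2 * |μ|))) ^ 2 * (2 * pairNormConst dWaveFormFactor) ^ 2 *
          (K : ℝ) ^ 2 / ℓ ^ 2 + 2 * (2 * pairNormConst dWaveFormFactor) ^ 2 / K +
        2 * (2 * pairNormConst dWaveFormFactor) ^ 2 * Real.exp (β * ℓ) * Real.exp (-(β * (L : ℝ) ^ 2 * (B * τ))))) - τ ≤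
      ((L : ℝ) ^ 2)⁻¹ * (gibbsState β (dWaveSourceTorus L U μ B)
        (pairField dWaveFormFactor L + (pairField dWaveFormFactor L)ᴴ)).re := by
  have hc : s ≤ (dWaveZ2System L 1 U μ dWaveFormFactor).moment β 1 := by
    rw [dWaveZ2System_moment_dWave, mul_one]; exact hcert
  have hN : 1 ≤ Fintype.card (TorusSite 2 L) := Fintype.card_pos
  have h := (dWaveZ2System L 1 U μ dWaveFormFactor).sqrt_sub_le_magnetisation_add hN hβ hB hτ hℓ hK hc
  rw [dWaveZ2System_magnetisation_dWave, card_torusSite_two L, Nat.cast_pow, abs_one, mul_one, Nat.cast_ofNat] at h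
  exact h

end Thermal

/-! ### §3. `T > 0`, every `t'`: KT93 Theorem 2.1 ((5.3) + (4.6)) on one torus for the pair-sourced `t–t'` torus -/

section ThermalTT

attribute [local instance 10000] instDecidableEqFermionTorusKT

/-- **KT93 THEOREM 2.1 IN ONE FINITE VOLUME FOR THE `d`-WAVE PAIR FIELD OF THE 2D `t–t'` HUBBARD MODEL (`T > 0`, EVERY `t'`).**
On `(ℤ/Lℤ)²`, `A_L(B) = dWaveSourceTorusTT' L t' U μ B = H_L(1,t',U) − μN − B(Δ_d+Δ_d†)` (both cuprate anchors `t' = 0`,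
`t' = −1/4`): if a number `s` satisfies `s ≤ L⁻⁴ Re⟨(Δ_d+Δ_d†)²⟩_{β, A_L(0)}` (a certified lower bound on the THERMAL pair long-range
order of the symmetric Gibbs state on THIS torus), then for every `β > 0`, `B > 0`, `τ ≥ 0`, `ℓ > 0`, `K ≥ 1`:
**`L⁻² Re⟨Δ_d+Δ_d†⟩_{β, A_L(B)} ≥ √(s − E) − τ`**, `E = 32(2rh̄)²ō²K²/ℓ² + 2ō²/K + 2ō²e^{βℓ}e^{−βL²Bτ}` with `r = 45`,
`h̄ = 45(2+|U|+2|μ|) + 18|t'|`, `ō = 2K_d` — `KomaTasaki.Z2System.sqrt_sub_le_magnetisation_add` over `dWaveZ2SystemTT'`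
(`DWaveKomaTasakiThermalTTPrime.lean`); the `t' ≠ 0` twin of `dWave_thermal_sourcedPairing_ge_finiteVolume`.  No thermodynamic
limit, no window on `t', U, μ, β`; NO thermal pair order of the Hubbard model is asserted (the number `s` is the input; at fixed `β`
in `d = 2` it tends to `0` with `L`, Koma–Tasaki 1992).
[cite: KomaTasaki1993, Theorem 2.1, §4 (4.6), §5 (5.3); p. 211] [cite: KomaTasaki1994, §3.3–3.4] [cite: XuEtAl2024, eq. (1)] -/
theorem dWave_thermal_sourcedPairing_ge_finiteVolume_TT' (L : ℕ) [NeZero L] (t' U μ : ℝ) {β : ℝ} (hβ : 0 < β) {B : ℝ}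
    (hB : 0 < B) {τ : ℝ} (hτ : 0 ≤ τ) {ℓ : ℝ} (hℓ : 0 < ℓ) {K : ℕ} (hK : 1 ≤ K) {s : ℝ}
    (hcert : s ≤ (((L : ℝ) ^ 2) ^ 2)⁻¹ * (gibbsState β (dWaveSourceTorusTT' L t' U μ 0)
      ((pairField dWaveFormFactor L + (pairField dWaveFormFactor L)ᴴ) ^ 2)).re) :
    Real.sqrt (s - (32 * (2 * 45 * (45 * (2 + |U| + 2 * |μ|) + 18 * |t'|)) ^ 2 * (2 * pairNormConst dWaveFormFactor) ^ 2 *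
          (K : ℝ) ^ 2 / ℓ ^ 2 + 2 * (2 * pairNormConst dWaveFormFactor) ^ 2 / K +
        2 * (2 * pairNormConst dWaveFormFactor) ^ 2 * Real.exp (β * ℓ) * Real.exp (-(β * (L : ℝ) ^ 2 * (B * τ))))) - τ ≤
      ((L : ℝ) ^ 2)⁻¹ * (gibbsState β (dWaveSourceTorusTT' L t' U μ B)
        (pairField dWaveFormFactor L + (pairField dWaveFormFactor L)ᴴ)).re := by
  have hc : s ≤ (dWaveZ2SystemTT' L t' U μ dWaveFormFactor).moment β 1 := by
    rw [dWaveZ2SystemTT'_moment_dWave, mul_one]; exact hcert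
  have hN : 1 ≤ Fintype.card (TorusSite 2 L) := Fintype.card_pos
  have h := (dWaveZ2SystemTT' L t' U μ dWaveFormFactor).sqrt_sub_le_magnetisation_add hN hβ hB hτ hℓ hK hc
  rw [dWaveZ2SystemTT'_magnetisation_dWave, card_torusSite_two L, Nat.cast_pow, Nat.cast_ofNat] at h
  exact h

end ThermalTT

end Literature.MathematicalPhysics.QuantumLattice
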